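import Mathlib
import Summits.NavierStokesRegularity.NavierStokesRegularity.Theorems.RootDecompLitSliceMeanFieldOneStep
import HarnessLib

/-!
# Mean-field lever, one-step toolkit V: the energy drop through a comparison slice

Helper file for the crux `RootDecompLitSlice.CritTameScarIsCritical` (Uᶜ, stmt-…-31733), continuing
`RootDecompLitSliceMeanFieldPairing` / `…OneStep`. On the classical tame frame (`ν > 0`, classical on
`[0, T) × ℝ³`, Leray–Hopf on `[0, T]` from `u 0`), for `t, s₀ ∈ (0, T)` with finite dissipation `F(s₀) < ∞` of
the comparison slice `w = u s₀` and clock bounds `∫‖u t − u T‖² ≤ α`, `∫‖u s₀ − u T‖² ≤ β`: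

`energyDrop_le : ∫‖u t‖² − ∫‖u T‖² ≤ α + 2 √α √β + 2 |∫_{(t,T)} flux(u s; u s₀) ds|`

— the identity `‖x‖² − ‖y‖² = ‖x − y‖² + 2⟨x − y, y − w⟩ + 2⟨x − y, w⟩` with `x = u t`, `y = u T`, `w = u s₀`,
Cauchy–Schwarz for the middle pairing, and the pairing identity
`MeanFieldPairing.inner_sub_inner_eq_integral_flux` for the last one (blueprint steps B1–B2 of the mean-field
lever; the flux is the one bounded by `MeanFieldOneStep.abs_integral_flux_le`).

All statements are over accepted `Literature.Analysis.FluidPDE` declarations and Mathlib; no new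
definitions. [cite: ConstantinFoias1988, Ch. 6, Ch. 8; Galdi2000, Lemma 2.1]
-/

set_option linter.dupNamespace false

namespace Summit.NavierStokesRegularity.NavierStokesRegularity.Theorems

open MeasureTheory Set Filter Topology Function Module
open scoped ENNReal NNReal RealInnerProductSpace
open Literature.Analysis.FluidPDE

namespace MeanFieldEnergyDrop

variable {ν T : ℝ} {u : ℝ → EuclideanSpace ℝ (Fin 3) → EuclideanSpace ℝ (Fin 3)}
  {p : ℝ → EuclideanSpace ℝ (Fin 3) → ℝ}

/-- `∫ ‖f‖² ≤ α` from the `ℝ≥0∞` clock bound `∫⁻ ‖f‖ₑ² ≤ ofReal α`. [folklore] -/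
theorem integral_norm_sq_le_of_lintegral_le {f : EuclideanSpace ℝ (Fin 3) → EuclideanSpace ℝ (Fin 3)}
    (hf : MemLp f 2 volume) {α : ℝ} (hα : 0 ≤ α)
    (h : ∫⁻ x, ‖f x‖ₑ ^ 2 ≤ ENNReal.ofReal α) : ∫ x, ‖f x‖ ^ 2 ≤ α := by
  have hi : Integrable (fun x => ‖f x‖ ^ 2) := by
    have := hf.integrable_norm_pow (by norm_num); simpa using this
  have heq : ENNReal.ofReal (∫ x, ‖f x‖ ^ 2) = ∫⁻ x, ‖f x‖ₑ ^ 2 := by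
    rw [ofReal_integral_eq_lintegral_ofReal hi (Filter.Eventually.of_forall fun x => sq_nonneg _)]
    refine lintegral_congr fun x => ?_
    rw [← ofReal_norm, ENNReal.ofReal_pow (norm_nonneg _)]
  exact (ENNReal.ofReal_le_ofReal_iff hα).1 (heq ▸ h)

/-- `⟪f, g⟫` is integrable for `f, g ∈ L²`. [folklore] -/
theorem integrable_inner_of_memLp {f g : EuclideanSpace ℝ (Fin 3) → EuclideanSpace ℝ (Fin 3)}
    (hf : MemLp f 2 volume) (hg : MemLp g 2 volume) : Integrable (fun x => ⟪f x, g x⟫) := by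
  have hf2 : Integrable (fun x => ‖f x‖ ^ 2) := by
    have := hf.integrable_norm_pow (by norm_num); simpa using this
  have hg2 : Integrable (fun x => ‖g x‖ ^ 2) := by
    have := hg.integrable_norm_pow (by norm_num); simpa using this
  refine ((hf2.add hg2).div_const 2).mono' (hf.1.inner hg.1) (Filter.Eventually.of_forall fun x => ?_)
  refine (norm_inner_le_norm _ _).trans ?_
  have h := two_mul_le_add_sq ‖f x‖ ‖g x‖
  simp only [Pi.add_apply]
  nlinarith [h]

/-- **The energy drop through a comparison slice.** On the classical tame frame, for `t, s₀ ∈ (0, T)`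
with `F(s₀) < ∞` and clock bounds `∫‖u t − u T‖² ≤ α`, `∫‖u s₀ − u T‖² ≤ β`:
`∫‖u t‖² − ∫‖u T‖² ≤ α + 2√α√β + 2 |∫_{(t,T)} flux|`, where the flux is that of the pairing identity
with the comparison field `w = u s₀` (`D = ‖u t − u T‖² + 2⟨u t − u T, u T − w⟩ + 2⟨u t − u T, w⟩` and
`⟨u t − u T, w⟩ = −∫ flux` by `MeanFieldPairing.inner_sub_inner_eq_integral_flux`). [folklore] -/
theorem energyDrop_le (hν : 0 < ν) (hT : 0 < T)
    (hcl : IsClassicalNSSolutionOn (Ico 0 T) ν 0 u p) (hLH : IsLerayHopfOn T ν 0 (u 0) u)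
    {t s₀ : ℝ} (ht : t ∈ Ioo 0 T) (hs₀ : s₀ ∈ Ioo 0 T)
    (hF₀ : (∫⁻ x, ENNReal.ofReal (frobeniusNormSq (fderiv ℝ (u s₀) x))) ≠ ⊤)
    {α β : ℝ} (hα : 0 ≤ α) (hβ : 0 ≤ β)
    (hct : ∫⁻ x, ‖u t x - u T x‖ₑ ^ 2 ≤ ENNReal.ofReal α)
    (hcs : ∫⁻ x, ‖u s₀ x - u T x‖ₑ ^ 2 ≤ ENNReal.ofReal β) :
    (∫ x, ‖u t x‖ ^ 2) - ∫ x, ‖u T x‖ ^ 2 ≤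
      α + 2 * (Real.sqrt α * Real.sqrt β) +
        2 * |∫ s in Ioo t T, ((∫ x, ⟪convect (u s) (u s₀) x, u s x⟫) -
          ν * ∑ i, ∫ x, ⟪fderiv ℝ (u s) x (stdOrthonormalBasis ℝ _ i),
            fderiv ℝ (u s₀) x (stdOrthonormalBasis ℝ _ i)⟫)| := by
  set b := stdOrthonormalBasis ℝ (EuclideanSpace ℝ (Fin 3)) with hb
  set flux : ℝ → ℝ := fun s => (∫ x, ⟪convect (u s) (u s₀) x, u s x⟫) -
    ν * ∑ i, ∫ x, ⟪fderiv ℝ (u s) x (b i), fderiv ℝ (u s₀) x (b i)⟫ with hflux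
  have hmt : MemLp (u t) 2 volume := hLH.memLp t ⟨ht.1.le, ht.2.le⟩
  have hmT : MemLp (u T) 2 volume := hLH.memLp T ⟨hT.le, le_rfl⟩
  have hms : MemLp (u s₀) 2 volume := hLH.memLp s₀ ⟨hs₀.1.le, hs₀.2.le⟩
  have hmf : MemLp (fun x => u t x - u T x) 2 volume := hmt.sub hmT
  have hmg : MemLp (fun x => u T x - u s₀ x) 2 volume := hmT.sub hms
  -- the pairing identity for `w = u s₀`
  have hw : ContDiff ℝ 1 (u s₀) :=
    (hcl.smooth_velocity.contDiff_slice ⟨hs₀.1.le, hs₀.2⟩).of_le (by norm_cast)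
  have hId := MeanFieldPairing.inner_sub_inner_eq_integral_flux hν hT hcl hLH hw hms
    (hcl.divFree s₀ ⟨hs₀.1.le, hs₀.2⟩) hF₀.lt_top ht
  -- integrable pieces
  have hf2 : Integrable (fun x => ‖u t x - u T x‖ ^ 2) := by
    have := hmf.integrable_norm_pow (by norm_num); simpa using this
  have hT2 : Integrable (fun x => ‖u T x‖ ^ 2) := by
    have := hmT.integrable_norm_pow (by norm_num); simpa using this
  have hfT := integrable_inner_of_memLp hmf hmT
  have hfg := integrable_inner_of_memLp hmf hmg
  have hfs := integrable_inner_of_memLp hmf hms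
  have hts := integrable_inner_of_memLp hmt hms
  have hTs := integrable_inner_of_memLp hmT hms
  -- the algebraic decomposition
  have hsq : (∫ x, ‖u t x‖ ^ 2) = (∫ x, ‖u t x - u T x‖ ^ 2) + 2 * (∫ x, ⟪u t x - u T x, u T x⟫) +
      ∫ x, ‖u T x‖ ^ 2 := by
    have hpt : (fun x => ‖u t x‖ ^ 2) =
        fun x => ‖u t x - u T x‖ ^ 2 + 2 * ⟪u t x - u T x, u T x⟫ + ‖u T x‖ ^ 2 := by
      funext x
      have := norm_add_sq_real (u t x - u T x) (u T x)
      rwa [sub_add_cancel] at this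
    have hA : Integrable (fun x => ‖u t x - u T x‖ ^ 2 + 2 * ⟪u t x - u T x, u T x⟫) :=
      hf2.add (hfT.const_mul 2)
    rw [hpt, integral_add hA hT2, integral_add hf2 (hfT.const_mul 2), integral_const_mul]
  have hsplit : (∫ x, ⟪u t x - u T x, u T x⟫) =
      (∫ x, ⟪u t x - u T x, u T x - u s₀ x⟫) + ∫ x, ⟪u t x - u T x, u s₀ x⟫ := by
    rw [← integral_add hfg hfs]
    refine integral_congr_ae (Filter.Eventually.of_forall fun x => ?_)
    simp only [← inner_add_right, sub_add_cancel]
  have hpair : (∫ x, ⟪u t x - u T x, u s₀ x⟫) = -∫ s in Ioo t T, flux s := by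
    have : (fun x => ⟪u t x - u T x, u s₀ x⟫) = fun x => ⟪u t x, u s₀ x⟫ - ⟪u T x, u s₀ x⟫ := by
      funext x; rw [inner_sub_left]
    rw [this, integral_sub hts hTs, hflux, ← hId]; ring
  -- the bounds
  have h1 : (∫ x, ‖u t x - u T x‖ ^ 2) ≤ α := integral_norm_sq_le_of_lintegral_le hmf hα hct
  have h2 : |∫ x, ⟪u t x - u T x, u T x - u s₀ x⟫| ≤ Real.sqrt α * Real.sqrt β := by
    have hβ' : (∫ x, ‖u T x - u s₀ x‖ ^ 2) ≤ β := by
      refine integral_norm_sq_le_of_lintegral_le hmg hβ ?_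
      refine le_of_eq_of_le (lintegral_congr fun x => ?_) hcs
      rw [← ofReal_norm, ← ofReal_norm, norm_sub_rev]
    have hcs' := integral_norm_mul_norm_le_sqrt_mul_sqrt (μ := volume) hmf hmg
    have hg2 : Integrable (fun x => ‖u T x - u s₀ x‖ ^ 2) := by
      have := hmg.integrable_norm_pow (by norm_num); simpa using this
    have hfgn : Integrable (fun x => ‖u t x - u T x‖ * ‖u T x - u s₀ x‖) := by
      refine ((hf2.add hg2).div_const 2).mono' (hmf.1.norm.mul hmg.1.norm)
        (Filter.Eventually.of_forall fun x => ?_)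
      rw [Real.norm_eq_abs, abs_of_nonneg (by positivity)]
      have h := two_mul_le_add_sq ‖u t x - u T x‖ ‖u T x - u s₀ x‖
      simp only [Pi.add_apply]
      nlinarith [h]
    rw [← Real.norm_eq_abs]
    refine (norm_integral_le_of_norm_le hfgn (Filter.Eventually.of_forall fun x =>
      norm_inner_le_norm _ _)).trans (hcs'.trans ?_)
    exact mul_le_mul (Real.sqrt_le_sqrt h1) (Real.sqrt_le_sqrt hβ') (Real.sqrt_nonneg _)
      (Real.sqrt_nonneg _)
  have h3 := le_abs_self (-(∫ s in Ioo t T, flux s))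
  rw [abs_neg] at h3
  have h2' := (abs_le.1 h2).2
  rw [hsq, hsplit, hpair]
  linarith

end MeanFieldEnergyDrop
end Summit.NavierStokesRegularity.NavierStokesRegularity.Theorems
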